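import Summits.AtomisticToContinuum.Crystallization.Theorems.ChartedZeroExcessLayeredLatticeLiouvilleZZZYRCX
import Summits.AtomisticToContinuum.Crystallization.Theorems.ChartedZeroExcessLayeredLatticeLiouvilleZZZYRCXN

/-!
# ChartedZeroExcessLayeredLatticeLiouville · ZZZYRCXO — THE θ⁰ KERNEL DECODE BRIDGE: kernel chords ↦ lens-2's `ChordDatum`, ONE SLAB
(decomp-a2c hand-1 g55; target stmt-AtomisticToContinuum-26636 JS-D near reader; critic r1852 (C)(iii), r1854 (A), r1857 (A): work-list item 2
«decode → `KernelSlabSound`»; reader statement of record = RCX (342) 978416d7)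

§1 DECODE: `siteN` (shifted ℕ triple ↦ lattice site), `liftN` (kernel piece ↦ lattice pair), ★ `decodeChord mX c : ChordDatum` (based pair `((0, mX), Y)`,
interior sites), `codeK` (signed piece key ↦ the kernel's ℕ key code), `wordZ` (the word as integers = lens-2's `wd`), `coefNpiece` (`coefN0` as a
function of the piece, `rfl`).
§2 BRIDGE IDENTITIES (`p = |w| ∣ 612`): `regW (wordZ w) (am − 600) = regN w p am`; ★ `n9W ∘ liftN = n9Z ∘ vecZ`, `d18W = d18Z`,
★ `keyN pr = codeK (pieceKeyW p (liftN pr))` for untruncated pieces (RCXN `piece_offsets`); `chordNodes/chordNp/chordPiece` of a decoded chord =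
the kernel's node list / code count / node-form pieces; `(decodeChord mX c).1 = liftN (chordX mX, dec3 (last code))`.
§3 ONE INCIDENCE: `coefR0 ≤ coefRn/2^E` and `coefNpiece ≤ coefNn/2^E` (RCXK `div_pow_le_ceilDivNat` + `d18_sq_le_four_n9_n9`: the ℕ subtraction is exact).
§4 ★★ ONE SLAB (`slabAcc w P9 E mX lo hi t0 cs = some T`, letters ≤ 2, `p ∣ 612`, `mX < min 601 p`, `P9 ≤ 2·10⁶`, `0 ≤ lo`, nonempty chords):
`slab_valid` (every decoded chord is based, in the window, pieces `0 < n9 ≤ P9` — the per-chord clause of `ChordDataValid`), `slab_nodup`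
(`lastCodesStrict` ⇒ based pairs distinct), ★ `slab_thetaR0_le` / `slab_thetaN0_le` (`thetaR0 (wordZ w) (cs.map (decodeChord mX)) k ≤ tabR T (codeK k)/2^E`,
same for N — the table half of `KernelSlabSound`, for ANY signed key `k`).  Completeness by the count files and the multi-slab / multi-residue
assembly to `KernelSlabSound (wordZ w) lo hi P9max E cd TRz TNz` are the sequel (RCXP).  Imports RCX + RCXN; 0 sorry.  All `[folklore]`.
-/

namespace Summit.AtomisticToContinuum.Crystallization.Theorems.ChartedZeroExcessLayeredLatticeLiouville.ThetaKernel

open scoped BigOperators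

/-! ## §1 decode -/

/-- the lattice site `(γ₀, γ₁, m)` of a shifted ℕ triple `(γ₀ + 600, γ₁ + 600, m + 600)`. -/
def siteN (t : ℕ × ℕ × ℕ) : Cell 2 × ℤ := (![(t.1 : ℤ) - 600, (t.2.1 : ℤ) - 600], (t.2.2 : ℤ) - 600)

/-- the lattice pair of a kernel piece. -/
def liftN (pr : (ℕ × ℕ × ℕ) × (ℕ × ℕ × ℕ)) : (Cell 2 × ℤ) × (Cell 2 × ℤ) := (siteN pr.1, siteN pr.2)

/-- ★ DECODE one chord (codes walked from the base site `(0, 0, mX)`) to lens-2's `ChordDatum`: based pair `X = (0, mX)`, `Y` = the site of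
the last code, interior = the sites of the other codes. -/
def decodeChord (mX : ℕ) (c : List ℕ) : ChordDatum :=
  (((0, (mX : ℤ)), siteN (dec3 (lastD c 0))), c.dropLast.map fun y => siteN (dec3 y))

/-- the ℕ code of a signed piece key `(m mod p, Δγ₀, Δγ₁, Δm)` (the kernel's `keyN` layout). -/
def codeK (k : ℤ × ℤ × ℤ × ℤ) : ℕ :=
  ((k.1.toNat * 1201 + (k.2.1 + 600).toNat) * 1201 + (k.2.2.1 + 600).toNat) * 1201 + (k.2.2.2 + 600).toNat

/-- the word as integers (lens-2's `wd`). -/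
def wordZ (w : List ℕ) : List ℤ := w.map (Nat.cast : ℕ → ℤ)

/-! ## §2 bridge identities -/

/-- the integer word has the same period. [folklore] -/
theorem length_wordZ (w : List ℕ) : (wordZ w).length = w.length := by unfold wordZ; exact List.length_map _

/-- entries of the integer word are the cast entries (default `0`). [folklore] -/
theorem getD_wordZ (w : List ℕ) (n : ℕ) : (wordZ w).getD n 0 = ((w.getD n 0 : ℕ) : ℤ) := by
  induction w generalizing n with
  | nil => simp [wordZ]
  | cons x rest ih =>
    cases n with
    | zero => simp [wordZ]
    | succ n => simp only [wordZ, List.map_cons, List.getD_cons_succ] at ih ⊢; exact ih n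

/-- ★ letters: lens-2's `regW` on the integer word at the signed layer `am − 600` IS the kernel's `regN` at the shifted layer `am`
(`p ∣ 612`). [folklore] -/
theorem regW_wordZ {w : List ℕ} (hp : w.length ∣ 612) (am : ℕ) : regW (wordZ w) ((am : ℤ) - 600) = (regN w w.length am : ℤ) := by
  unfold regW regN
  rw [length_wordZ, layer_emod_toNat hp am, getD_wordZ]

/-- `siteN` is injective. [folklore] -/
theorem siteN_inj {t t' : ℕ × ℕ × ℕ} (h : siteN t = siteN t') : t = t' := by
  obtain ⟨a, b, c⟩ := t
  obtain ⟨a', b', c'⟩ := t'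
  simp only [siteN, Prod.mk.injEq] at h
  obtain ⟨h1, h3⟩ := h
  have ha := congrFun h1 0
  have hb := congrFun h1 1
  simp only [Matrix.cons_val_zero, Matrix.cons_val_one] at ha hb
  simp only [Prod.mk.injEq]
  refine ⟨?_, ?_, ?_⟩ <;> omega

/-- the base site decodes to lens-2's based `X = (0, mX)`. [folklore] -/
theorem siteN_chordX (mX : ℕ) : siteN (chordX mX) = ((0 : Cell 2), (mX : ℤ)) := by
  simp only [siteN, chordX, Prod.mk.injEq]
  refine ⟨?_, by push_cast; ring⟩
  funext i
  fin_cases i <;> simp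

/-- ★ `n9W` of a lifted piece IS the kernel's `n9Z ∘ vecZ`. [folklore] -/
theorem n9W_liftN {w : List ℕ} (hp : w.length ∣ 612) (pr : (ℕ × ℕ × ℕ) × (ℕ × ℕ × ℕ)) :
    n9W (wordZ w) (liftN pr) = n9Z (vecZ w w.length pr) := by
  simp only [n9W, refW0, refW1, liftN, siteN, Matrix.cons_val_zero, Matrix.cons_val_one, regW_wordZ hp, n9Z, vecZ]
  ring

/-- ★ `d18W` of two lifted pieces IS the kernel's `d18Z` of their vectors. [folklore] -/
theorem d18W_liftN {w : List ℕ} (hp : w.length ∣ 612) (pr pr' : (ℕ × ℕ × ℕ) × (ℕ × ℕ × ℕ)) :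
    d18W (wordZ w) (liftN pr) (liftN pr') = d18Z (vecZ w w.length pr) (vecZ w w.length pr') := by
  simp only [d18W, refW0, refW1, liftN, siteN, Matrix.cons_val_zero, Matrix.cons_val_one, regW_wordZ hp, d18Z_eq, vecZ]
  ring

/-- ★ the KEY: for a piece without truncation (`|Δγ₀|, |Δγ₁|, |Δm| ≤ 600`, e.g. by `piece_offsets`) the kernel's ℕ key code is the code of
lens-2's signed key of the lifted piece (`p ∣ 612`). [folklore] -/
theorem keyN_eq_codeK {w : List ℕ} (hp : w.length ∣ 612) (pr : (ℕ × ℕ × ℕ) × (ℕ × ℕ × ℕ))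
    (h0 : pr.1.1 ≤ pr.2.1 + 600) (h1 : pr.1.2.1 ≤ pr.2.2.1 + 600) (hm : pr.1.2.2 ≤ pr.2.2.2 + 600) :
    keyN w.length pr = codeK (pieceKeyW w.length (liftN pr)) := by
  obtain ⟨⟨a0, a1, am⟩, ⟨b0, b1, bm⟩⟩ := pr
  simp only at h0 h1 hm
  have e0 : ((b0 : ℤ) - 600 - ((a0 : ℤ) - 600) + 600).toNat = b0 + 600 - a0 := by
    have : (b0 : ℤ) - 600 - ((a0 : ℤ) - 600) + 600 = ((b0 + 600 - a0 : ℕ) : ℤ) := by push_cast [Nat.cast_sub h0]; ring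
    rw [this, Int.toNat_natCast]
  have e1 : ((b1 : ℤ) - 600 - ((a1 : ℤ) - 600) + 600).toNat = b1 + 600 - a1 := by
    have : (b1 : ℤ) - 600 - ((a1 : ℤ) - 600) + 600 = ((b1 + 600 - a1 : ℕ) : ℤ) := by push_cast [Nat.cast_sub h1]; ring
    rw [this, Int.toNat_natCast]
  have em : ((bm : ℤ) - 600 - ((am : ℤ) - 600) + 600).toNat = bm + 600 - am := by
    have : (bm : ℤ) - 600 - ((am : ℤ) - 600) + 600 = ((bm + 600 - am : ℕ) : ℤ) := by push_cast [Nat.cast_sub hm]; ring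
    rw [this, Int.toNat_natCast]
  simp only [keyN, codeK, pieceKeyW, liftN, siteN, Matrix.cons_val_zero, Matrix.cons_val_one, layer_emod_toNat hp, e0, e1, em]

/-- `lastD` is `List.getLast` on a nonempty list. [folklore] -/
theorem lastD_eq_getLast : ∀ (c : List ℕ) (d : ℕ) (h : c ≠ []), lastD c d = c.getLast h
  | [], _, h => absurd rfl h
  | y :: rest, d, _ => by
    rw [lastD_cons]
    by_cases hr : rest = []
    · subst hr; rfl
    · rw [List.getLast_cons hr]; exact lastD_eq_getLast rest y hr

/-- the node list of a decoded nonempty chord is the lifted kernel node list `(chordX mX :: c.map dec3).map siteN`. [folklore] -/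
theorem chordNodes_decodeChord (mX : ℕ) {c : List ℕ} (hc : c ≠ []) :
    chordNodes (decodeChord mX c) = (chordX mX :: c.map dec3).map siteN := by
  rw [List.map_cons, siteN_chordX]
  unfold chordNodes decodeChord
  simp only
  congr 1
  rw [lastD_eq_getLast c 0 hc]
  have h : c.dropLast.map (fun y => siteN (dec3 y)) ++ [siteN (dec3 (c.getLast hc))] =
      (c.dropLast ++ [c.getLast hc]).map fun y => siteN (dec3 y) := by simp
  rw [h, List.dropLast_append_getLast hc, List.map_map]
  rfl

/-- a decoded nonempty chord has as many pieces as codes. [folklore] -/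
theorem chordNp_decodeChord (mX : ℕ) {c : List ℕ} (hc : c ≠ []) : chordNp (decodeChord mX c) = c.length := by
  unfold chordNp decodeChord
  simp only [List.length_map, List.length_dropLast]
  have := List.length_pos_iff.mpr hc
  omega

/-- ★ piece `i` of a decoded chord is the lift of the kernel's node-form piece `i` (default = the last node). [folklore] -/
theorem chordPiece_decodeChord (mX : ℕ) {c : List ℕ} (hc : c ≠ []) (i : ℕ) :
    chordPiece (decodeChord mX c) i =
      liftN ((chordX mX :: c.map dec3).getD i (dec3 (lastD c 0)), (c.map dec3).getD i (dec3 (lastD c 0))) := by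
  have hY : (decodeChord mX c).1.2 = siteN (dec3 (lastD c 0)) := rfl
  unfold chordPiece
  rw [chordNodes_decodeChord mX hc, hY, List.getD_map, List.getD_map, liftN]
  simp only [List.getD_cons_succ]

/-- the based pair of a decoded chord is the lift of the kernel's chord `(X, Y)`. [folklore] -/
theorem decodeChord_fst (mX : ℕ) (c : List ℕ) : (decodeChord mX c).1 = liftN (chordX mX, dec3 (lastD c 0)) := by
  rw [liftN, siteN_chordX]; rfl

/-- hence its ideal length is the kernel's `n9Z (chordE …)`. [folklore] -/
theorem n9W_decodeChord_fst {w : List ℕ} (hp : w.length ∣ 612) (mX : ℕ) (c : List ℕ) :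
    n9W (wordZ w) (decodeChord mX c).1 = n9Z (chordE w w.length mX c) := by
  rw [decodeChord_fst, n9W_liftN hp]; rfl

/-! ## §3 reading the tables: one incidence -/

/-- filter-then-sum is the sum of the indicator-weighted terms. [folklore] -/
theorem sum_map_filter_eq_sum_ite {α : Type*} (l : List α) (P : α → Prop) [DecidablePred P] (f : α → ℕ) :
    ((l.filter fun x => P x).map f).sum = (l.map fun x => if P x then f x else 0).sum := by
  induction l with
  | nil => simp
  | cons x rest ih =>
    rw [List.filter_cons, List.map_cons, List.sum_cons]
    by_cases hx : P x
    · simp [hx, ih]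
    · simp [hx, ih]

/-- the R coefficient of an incidence is dominated by the kernel's dyadic `coefRn / 2^E` (`u9 > 0`). [folklore] -/
theorem coefR0_le {w : List ℕ} (hp : w.length ∣ 612) {E mX : ℕ} {c : List ℕ} (hc : c ≠ []) (hu : 0 < n9Z (chordE w w.length mX c)) :
    coefR0 (wordZ w) (decodeChord mX c) ≤ (coefRn (2 ^ E * 45927 * c.length) (n9Z (chordE w w.length mX c)).toNat : ℝ) / 2 ^ E := by
  set u9 := n9Z (chordE w w.length mX c) with hu9
  have hun : ((u9.toNat : ℕ) : ℤ) = u9 := Int.toNat_of_nonneg hu.le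
  have hunR : ((u9.toNat : ℕ) : ℝ) = (u9 : ℝ) := by exact_mod_cast hun
  have hupos : (0 : ℝ) < (u9 : ℝ) := by exact_mod_cast hu
  have hb : 0 < u9.toNat * u9.toNat * (u9.toNat * u9.toNat) := by
    have : 0 < u9.toNat := by omega
    positivity
  have h := div_pow_le_ceilDivNat (2 ^ E * 45927 * c.length) E hb
  have heq : coefR0 (wordZ w) (decodeChord mX c) =
      ((2 ^ E * 45927 * c.length : ℕ) : ℝ) / (2 ^ E * ((u9.toNat * u9.toNat * (u9.toNat * u9.toNat) : ℕ) : ℝ)) := by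
    unfold coefR0
    rw [chordNp_decodeChord mX hc, n9W_decodeChord_fst hp, ← hu9]
    push_cast
    rw [hunR]
    field_simp
  rw [heq]
  exact h

/-- the N coefficient of an incidence, as a function of the PIECE `y` (lens-2's `coefN0 wd c i` is this at `y = chordPiece c i`, by `rfl`). -/
noncomputable def coefNpiece (wd : List ℤ) (c : ChordDatum) (y : (Cell 2 × ℤ) × (Cell 2 × ℤ)) : ℝ :=
  (chordNp c : ℝ) * 45927 * (1 - (d18W wd c.1 y : ℝ) ^ 2 / (4 * n9W wd c.1 * n9W wd y)) / (n9W wd c.1 : ℝ) ^ 4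

/-- `coefN0` is `coefNpiece` at the piece. [folklore] -/
theorem coefN0_eq_coefNpiece (wd : List ℤ) (c : ChordDatum) (i : ℕ) : coefN0 wd c i = coefNpiece wd c (chordPiece c i) := rfl

/-- the N coefficient of a lifted piece is dominated by the kernel's dyadic `coefNn / 2^E` (Cauchy–Schwarz makes the ℕ subtraction exact).
[folklore] -/
theorem coefNpiece_le {w : List ℕ} (hp : w.length ∣ 612) {E mX : ℕ} {c : List ℕ} (hc : c ≠ []) (hu : 0 < n9Z (chordE w w.length mX c))
    {pr : (ℕ × ℕ × ℕ) × (ℕ × ℕ × ℕ)} (hv : 0 < n9Z (vecZ w w.length pr)) :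
    coefNpiece (wordZ w) (decodeChord mX c) (liftN pr) ≤
      (coefNn (2 ^ E * 45927 * c.length)
          (4 * ((n9Z (chordE w w.length mX c)).toNat * (n9Z (chordE w w.length mX c)).toNat *
            ((n9Z (chordE w w.length mX c)).toNat * (n9Z (chordE w w.length mX c)).toNat)) * (n9Z (chordE w w.length mX c)).toNat)
          (4 * (n9Z (chordE w w.length mX c)).toNat) (n9Z (vecZ w w.length pr)).toNat
          (d18Z (chordE w w.length mX c) (vecZ w w.length pr)).natAbs : ℝ) / 2 ^ E := by
  set e := chordE w w.length mX c with he
  set v := vecZ w w.length pr with hvv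
  set u9 := n9Z e with hu9
  set p9 := n9Z v with hp9
  set d := d18Z e v with hd
  have hun : ((u9.toNat : ℕ) : ℤ) = u9 := Int.toNat_of_nonneg hu.le
  have hpn : ((p9.toNat : ℕ) : ℤ) = p9 := Int.toNat_of_nonneg hv.le
  have hdn : ((d.natAbs : ℕ) : ℤ) * d.natAbs = d * d := Int.natAbs_mul_self' d
  -- Cauchy–Schwarz: `d² ≤ 4·u9·p9`
  have hCS : d * d ≤ 4 * u9 * p9 := by
    have h := d18_sq_le_four_n9_n9 e.1 e.2.1 e.2.2 v.1 v.2.1 v.2.2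
    rw [hd, d18Z_eq, hu9, hp9]
    simp only [n9Z]
    nlinarith [h]
  have hCSn : d.natAbs * d.natAbs ≤ 4 * u9.toNat * p9.toNat := by
    have : ((d.natAbs * d.natAbs : ℕ) : ℤ) ≤ ((4 * u9.toNat * p9.toNat : ℕ) : ℤ) := by
      rw [Nat.cast_mul, hdn, Nat.cast_mul, Nat.cast_mul, hun, hpn]
      exact_mod_cast hCS
    exact_mod_cast this
  have hb : 0 < 4 * (u9.toNat * u9.toNat * (u9.toNat * u9.toNat)) * u9.toNat * p9.toNat := by
    have : 0 < u9.toNat := by omega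
    have : 0 < p9.toNat := by omega
    positivity
  have h := div_pow_le_ceilDivNat (2 ^ E * 45927 * c.length * (4 * u9.toNat * p9.toNat - d.natAbs * d.natAbs)) E hb
  have hunR : ((u9.toNat : ℕ) : ℝ) = (u9 : ℝ) := by exact_mod_cast hun
  have hpnR : ((p9.toNat : ℕ) : ℝ) = (p9 : ℝ) := by exact_mod_cast hpn
  have hdnR : |(d : ℝ)| * |(d : ℝ)| = (d : ℝ) * d := abs_mul_abs_self _
  have hupos : (0 : ℝ) < (u9 : ℝ) := by exact_mod_cast hu
  have hppos : (0 : ℝ) < (p9 : ℝ) := by exact_mod_cast hv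
  have hpiece : n9W (wordZ w) (liftN pr) = p9 := by rw [n9W_liftN hp]
  have hd18 : d18W (wordZ w) (decodeChord mX c).1 (liftN pr) = d := by
    rw [decodeChord_fst, d18W_liftN hp]; rfl
  have heq : coefNpiece (wordZ w) (decodeChord mX c) (liftN pr) =
      ((2 ^ E * 45927 * c.length * (4 * u9.toNat * p9.toNat - d.natAbs * d.natAbs) : ℕ) : ℝ) /
        (2 ^ E * ((4 * (u9.toNat * u9.toNat * (u9.toNat * u9.toNat)) * u9.toNat * p9.toNat : ℕ) : ℝ)) := by
    have hsub : ((4 * u9.toNat * p9.toNat - d.natAbs * d.natAbs : ℕ) : ℝ) = 4 * (u9 : ℝ) * p9 - (d : ℝ) * d := by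
      rw [Nat.cast_sub hCSn]
      push_cast
      rw [hunR, hpnR]
      simp only [Nat.cast_natAbs, Int.cast_abs, hdnR]
    unfold coefNpiece
    rw [chordNp_decodeChord mX hc, n9W_decodeChord_fst hp, hpiece, hd18, ← he, ← hu9, Nat.cast_mul, hsub]
    push_cast
    rw [hunR, hpnR]
    field_simp
  rw [heq]
  exact h

/-! ## §4 one slab: validity, distinct chords, tables -/

section Slab

variable {w : List ℕ} {P9 E mX : ℕ} {lo hi : ℤ} {t0 : PT} {cs : List (List ℕ)} {T : List (ℕ × ℕ × ℕ)}

/-- ★ ONE SLAB DECODED — VALIDITY: every decoded chord is based at `(0, mX)`, its ideal length lies in the slab window, and every piece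
has `0 < n9 ≤ P9max`. [folklore] -/
theorem slab_valid (hw : ∀ x, regN w w.length x ≤ 2) (hp : w.length ∣ 612) (hmX : mX < 601) (hmXp : mX < w.length)
    (hne : ∀ c ∈ cs, c ≠ []) (h : slabAcc w P9 E mX lo hi t0 cs = some T) :
    ∀ c' ∈ cs.map (decodeChord mX), c'.1.1.1 = 0 ∧ 0 ≤ c'.1.1.2 ∧ c'.1.1.2 < ((wordZ w).length : ℤ) ∧
      lo < n9W (wordZ w) c'.1 ∧ n9W (wordZ w) c'.1 ≤ hi ∧
      ∀ i < chordNp c', 0 < n9W (wordZ w) (chordPiece c' i) ∧ n9W (wordZ w) (chordPiece c' i) ≤ (P9 : ℤ) := by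
  intro c' hc'
  obtain ⟨c, hc, rfl⟩ := List.mem_map.mp hc'
  obtain ⟨H1, -, -⟩ := slabAcc_sound w P9 E mX hw hmX lo hi t0 cs T h
  obtain ⟨hlo, hhi, hpieces⟩ := H1 c hc
  refine ⟨rfl, ?_, ?_, ?_, ?_, fun i hi' => ?_⟩
  · show (0 : ℤ) ≤ (mX : ℤ); positivity
  · show (mX : ℤ) < ((wordZ w).length : ℤ); rw [length_wordZ]; exact_mod_cast hmXp
  · rw [n9W_decodeChord_fst hp]; exact hlo
  · rw [n9W_decodeChord_fst hp]; exact hhi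
  · rw [chordNp_decodeChord mX (hne c hc)] at hi'
    rw [chordPiece_decodeChord mX (hne c hc) i, n9W_liftN hp]
    obtain ⟨-, -, -, h0, hP⟩ := hpieces _ (nodePiece_mem_piecesFrom c (chordX mX) (dec3 (lastD c 0)) hi')
    exact ⟨h0, hP⟩

/-- ★ ONE SLAB DECODED — DISTINCT CHORDS: strictly increasing last codes ⇒ the based pairs are pairwise distinct. [folklore] -/
theorem slab_nodup (hstrict : lastCodesStrict cs = true) : ((cs.map (decodeChord mX)).map fun c => c.1).Nodup := by
  have hnd := nodup_lastCodes_of_strict hstrict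
  have key : (cs.map (decodeChord mX)).map (fun c => c.1) = (cs.map fun c => lastD c 0).map fun y => liftN (chordX mX, dec3 y) := by
    rw [List.map_map, List.map_map]
    exact List.map_congr_left fun c _ => decodeChord_fst mX c
  rw [key]
  refine hnd.map_on fun y _ y' _ hyy => dec3_inj (siteN_inj ?_)
  have := congrArg Prod.snd hyy
  simpa [liftN] using this

/-- the real form of a kernel chord sum: `Σ` over the pieces of `ite (keyN = q) a 0`, cast and divided. [folklore] -/
theorem cast_sum_filter_div (L : List ((ℕ × ℕ × ℕ) × (ℕ × ℕ × ℕ))) (q : ℕ) (a : (ℕ × ℕ × ℕ) × (ℕ × ℕ × ℕ) → ℕ) (D : ℝ) :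
    ((((L.filter fun pr => keyN w.length pr = q).map a).sum : ℕ) : ℝ) / D =
      (L.map fun pr => if keyN w.length pr = q then (a pr : ℝ) / D else 0).sum := by
  rw [sum_map_filter_eq_sum_ite, Nat.cast_list_sum, List.map_map, div_eq_mul_inv, ← List.sum_map_mul_right]
  congr 1
  refine List.map_congr_left fun pr _ => ?_
  simp only [Function.comp]
  split_ifs <;> simp [div_eq_mul_inv]

/-- ★ ONE SLAB DECODED — THE R TABLE: `thetaR0` of the decoded data at ANY signed key `k` is at most the kernel table's key-wise R sum at
`codeK k`, read at the dyadic exponent `E`. [folklore] -/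
theorem slab_thetaR0_le (hw : ∀ x, regN w w.length x ≤ 2) (hp : w.length ∣ 612) (hmX : mX < 601) (hP9 : P9 ≤ 2000000) (hlo : 0 ≤ lo)
    (hne : ∀ c ∈ cs, c ≠ []) (h : slabAcc w P9 E mX lo hi t0 cs = some T) (k : ℤ × ℤ × ℤ × ℤ) :
    thetaR0 (wordZ w) (cs.map (decodeChord mX)) k ≤ (tabR T (codeK k) : ℝ) / 2 ^ E := by
  obtain ⟨H1, H2, -⟩ := slabAcc_sound w P9 E mX hw hmX lo hi t0 cs T h
  have hpow : (0 : ℝ) < 2 ^ E := by positivity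
  -- per chord
  have hchord : ∀ c ∈ cs, (∑ i ∈ Finset.range (chordNp (decodeChord mX c)),
      (if pieceKeyW (wordZ w).length (chordPiece (decodeChord mX c) i) = k then coefR0 (wordZ w) (decodeChord mX c) else 0)) ≤
      (chordR w w.length (2 ^ E * 45927) mX c (codeK k) : ℝ) / 2 ^ E := by
    intro c hc
    have hcn := hne c hc
    obtain ⟨hlo', -, hpieces⟩ := H1 c hc
    have hu : 0 < n9Z (chordE w w.length mX c) := lt_of_le_of_lt hlo hlo'
    rw [chordNp_decodeChord mX hcn, length_wordZ,
      Finset.sum_congr rfl fun i _ => by rw [chordPiece_decodeChord mX hcn i],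
      ← sum_map_piecesFrom (fun pr => if pieceKeyW w.length (liftN pr) = k then coefR0 (wordZ w) (decodeChord mX c) else 0)
        (dec3 (lastD c 0)) c (chordX mX)]
    unfold chordR
    rw [cast_sum_filter_div]
    refine List.sum_le_sum fun pr hpr => ?_
    obtain ⟨-, -, -, h0, hP⟩ := hpieces pr hpr
    obtain ⟨o1, -, o2, -, o3, -⟩ := piece_offsets w w.length hw hP9 pr hP
    by_cases hk : pieceKeyW w.length (liftN pr) = k
    · have hq : keyN w.length pr = codeK k := by rw [keyN_eq_codeK hp pr o1 o2 o3, hk]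
      simp only [hk, hq, if_true]
      exact coefR0_le hp hcn hu
    · simp only [hk, if_false]
      split_ifs <;> positivity
  -- sum over chords
  unfold thetaR0
  rw [List.map_map]
  calc ((cs.map ((fun c => ∑ i ∈ Finset.range (chordNp c),
          if pieceKeyW (wordZ w).length (chordPiece c i) = k then coefR0 (wordZ w) c else 0) ∘ decodeChord mX))).sum
      ≤ (cs.map fun c => (chordR w w.length (2 ^ E * 45927) mX c (codeK k) : ℝ) / 2 ^ E).sum :=
        List.sum_le_sum fun c hc => hchord c hc
    _ = ((cs.map fun c => chordR w w.length (2 ^ E * 45927) mX c (codeK k)).sum : ℕ) / 2 ^ E := by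
        rw [Nat.cast_list_sum, List.map_map, div_eq_mul_inv, ← List.sum_map_mul_right]
        rfl
    _ ≤ (tabR T (codeK k) : ℝ) / 2 ^ E := by
        gcongr
        exact_mod_cast H2 (codeK k)

/-- ★ ONE SLAB DECODED — THE N TABLE: likewise for `thetaN0` and the key-wise N sums. [folklore] -/
theorem slab_thetaN0_le (hw : ∀ x, regN w w.length x ≤ 2) (hp : w.length ∣ 612) (hmX : mX < 601) (hP9 : P9 ≤ 2000000) (hlo : 0 ≤ lo)
    (hne : ∀ c ∈ cs, c ≠ []) (h : slabAcc w P9 E mX lo hi t0 cs = some T) (k : ℤ × ℤ × ℤ × ℤ) :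
    thetaN0 (wordZ w) (cs.map (decodeChord mX)) k ≤ (tabN T (codeK k) : ℝ) / 2 ^ E := by
  obtain ⟨H1, -, H3⟩ := slabAcc_sound w P9 E mX hw hmX lo hi t0 cs T h
  have hpow : (0 : ℝ) < 2 ^ E := by positivity
  have hchord : ∀ c ∈ cs, (∑ i ∈ Finset.range (chordNp (decodeChord mX c)),
      (if pieceKeyW (wordZ w).length (chordPiece (decodeChord mX c) i) = k then coefN0 (wordZ w) (decodeChord mX c) i else 0)) ≤
      (chordN w w.length (2 ^ E * 45927) mX c (codeK k) : ℝ) / 2 ^ E := by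
    intro c hc
    have hcn := hne c hc
    obtain ⟨hlo', -, hpieces⟩ := H1 c hc
    have hu : 0 < n9Z (chordE w w.length mX c) := lt_of_le_of_lt hlo hlo'
    simp only [coefN0_eq_coefNpiece]
    rw [chordNp_decodeChord mX hcn, length_wordZ,
      Finset.sum_congr rfl fun i _ => by rw [chordPiece_decodeChord mX hcn i],
      ← sum_map_piecesFrom (fun pr => if pieceKeyW w.length (liftN pr) = k then coefNpiece (wordZ w) (decodeChord mX c) (liftN pr) else 0)
        (dec3 (lastD c 0)) c (chordX mX)]
    unfold chordN
    rw [cast_sum_filter_div]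
    refine List.sum_le_sum fun pr hpr => ?_
    obtain ⟨-, -, -, h0, hP⟩ := hpieces pr hpr
    obtain ⟨o1, -, o2, -, o3, -⟩ := piece_offsets w w.length hw hP9 pr hP
    by_cases hk : pieceKeyW w.length (liftN pr) = k
    · have hq : keyN w.length pr = codeK k := by rw [keyN_eq_codeK hp pr o1 o2 o3, hk]
      simp only [hk, hq, if_true]
      exact coefNpiece_le hp hcn hu h0
    · simp only [hk, if_false]
      split_ifs <;> positivity
  unfold thetaN0
  rw [List.map_map]
  calc ((cs.map ((fun c => ∑ i ∈ Finset.range (chordNp c),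
          if pieceKeyW (wordZ w).length (chordPiece c i) = k then coefN0 (wordZ w) c i else 0) ∘ decodeChord mX))).sum
      ≤ (cs.map fun c => (chordN w w.length (2 ^ E * 45927) mX c (codeK k) : ℝ) / 2 ^ E).sum :=
        List.sum_le_sum fun c hc => hchord c hc
    _ = ((cs.map fun c => chordN w w.length (2 ^ E * 45927) mX c (codeK k)).sum : ℕ) / 2 ^ E := by
        rw [Nat.cast_list_sum, List.map_map, div_eq_mul_inv, ← List.sum_map_mul_right]
        rfl
    _ ≤ (tabN T (codeK k) : ℝ) / 2 ^ E := by
        gcongr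
        exact_mod_cast H3 (codeK k)

end Slab

end Summit.AtomisticToContinuum.Crystallization.Theorems.ChartedZeroExcessLayeredLatticeLiouville.ThetaKernel
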